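import Literature.Computation.KummerOrbifold.Certificate5
import HarnessLib

/-!
# Kummer orbifold model, `m = 5` (`Kum⁴`): the seeds are homogeneous of their recorded degrees
# (COMPUTATIONAL, `native_decide`; cell `hodge-kum4`, seat p1)

Area `Literature/Computation/KummerOrbifold` (sequel of `Certificate5`).  A small certificate about the
17 seed vectors `seeds5` of the certified `A[5]`-invariant Fu–Tian–Vial / Fantechi–Göttsche model
(the unit, the `7 + 8` block-basis classes of degrees `2` and `3`, and `ω₀`): every raw index in the
support of seed `s` carries the degree-operator eigenvalue `seedDeg s - 8` (`degOK5`), and the recorded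
degrees are `[0, 2,2,2,2,2,2,2, 3,3,3,3,3,3,3,3, 2]`.  KERNEL CONSEQUENCE (no further computation,
via `Replay.colOp_diagCol_of_all`): **`degOp_seedVec`** — `h (seedVec s) = (seedDeg s - 8) • seedVec s`
for every `s` over every field of characteristic `0`.  Consumer: the Summits-side necessary-condition
lemma for the route item MODEL_X (`Summit.Ventures.HodgeKum4.KummerOrbifoldModelKum4`,
stmt-Ventures-19267), which reads off the degree of a seed's cohomological preimage from the
`h`-intertwining clause of `ModelCore`.  Nothing here concerns the identification half of MODEL_X.

Sources: as `Certificate5` (Fu–Tian–Vial 2019 Thm. 1.5; Fantechi–Göttsche 2003 §3; Looijenga–Lunts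
1997 §1, the degree operator `h`).
-/

set_option autoImplicit false

namespace Literature.Computation.KummerOrbifold

open Literature.Computation.Sparse SpVec

/-- **(certificate)** Every seed vector is homogeneous of its recorded degree: all raw indices in the
support of `seeds5[s]` have `hdeg5 = seedDeg s - 8`; and the recorded seed degrees are
`0, 2 (×7), 3 (×8), 2`. [cite: LooijengaLunts1997, §1 p. 4 (the degree operator h of a graded module)] -/
theorem seeds5_degOK :
    (seeds5.all degOK5 &&
      (seeds5.toList.map Prod.fst == [0, 2, 2, 2, 2, 2, 2, 2, 3, 3, 3, 3, 3, 3, 3, 3, 2])) = true := by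
  native_decide

/-- Every seed entry (and the default entry beyond the array) passes `degOK5`. [cite: LooijengaLunts1997, §1 p. 4 (the degree operator h of a graded module)] -/
theorem degOK5_seeds5_getD (s : ℕ) : degOK5 (seeds5.getD s (0, [])) = true := by
  have h := seeds5_degOK
  rw [Bool.and_eq_true] at h
  have hall := h.1
  rw [Array.getD_eq_getD_getElem?]
  by_cases hs : s < seeds5.size
  · rw [Array.getElem?_eq_getElem hs, Option.getD_some]
    exact (Array.all_eq_true.mp hall) s hs
  · rw [Array.getElem?_eq_none (Nat.le_of_not_lt hs), Option.getD_none]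
    rfl

/-- The recorded seed degrees, as a list: `seedDeg s` for `s = 0, …, 16`. [cite: FuTianVial2019, Thm. 1.5 (and Thm. 1.4; the orbifold product of §2 with discrete torsion)] -/
theorem seedDeg_list :
    (List.range 17).map seedDeg = [0, 2, 2, 2, 2, 2, 2, 2, 3, 3, 3, 3, 3, 3, 3, 3, 2] := by
  have h := seeds5_degOK
  rw [Bool.and_eq_true] at h
  have h2 : seeds5.toList.map Prod.fst = [0, 2, 2, 2, 2, 2, 2, 2, 3, 3, 3, 3, 3, 3, 3, 3, 2] := by
    simpa using h.2
  have hsize : seeds5.size = 17 := by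
    simpa using congrArg List.length h2
  rw [← h2]
  apply List.ext_getElem
  · simp [hsize]
  · intro i h₁ h₃
    simp only [List.length_map, List.length_range] at h₁
    simp only [List.getElem_map, List.getElem_range, Array.getElem_toList, seedDeg]
    rw [Array.getD_eq_getD_getElem?, Array.getElem?_eq_getElem (by omega), Option.getD_some]

variable (K : Type*) [Field K] [CharZero K]

/-- **`h` on the seeds**: `degOp (seedVec s) = (seedDeg s - 8) • seedVec s` for every `s` (for
`s ≥ 17` both sides vanish). [cite: LooijengaLunts1997, §1 p. 4 (the degree operator h of a graded module)] -/
theorem degOp_seedVec (s : ℕ) : degOp K (seedVec K s) = ((seedDeg s : K) - 8) • seedVec K s := by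
  have h := degOK5_seeds5_getD s
  unfold degOK5 at h
  unfold degOp seedVec seedDeg
  rw [colOp_diagCol_of_all K hdeg5 (((seeds5.getD s (0, [])).1 : ℚ) - 8) _ h, Rat.cast_sub,
    Rat.cast_natCast, Rat.cast_ofNat]

end Literature.Computation.KummerOrbifold
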